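import Literature.AlgebraicGeometry.Resolution.NormalizationInExtension
import Literature.AlgebraicGeometry.Motives.CyclesPushforwardNormProofs
import HarnessLib

/-!
# Compactifying a finite cover of an open of a variety: the normalization of `Y` in `U' → U ⊆ Y`

Topic: `Literature/AlgebraicGeometry/Resolution`. In de Jong 1996, 4.17 a finite (étale) cover
`U' → U` of a non-empty open `U ⊆ Y` of a projective variety `Y` is compactified over `Y`:

> "Let `U' ⊂ U ×_{M_{g,n}} ℓM_{g,n}` be an irreducible component; it is finite étale over `U`
> […]. Put `Y'` equal to the closure of `Im(U' → Y ×_k ℓM̄_{g,n})`. It is clear that `Y'` is a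
> projective variety over `k` and that `ψ : Y' → Y` is an alteration which is generically
> étale." (p. 72)

The first, purely `Y`-sided half of this is the **normalization `N` of `Y` in `U'`**, i.e.
Mathlib's relative normalization `Scheme.Hom.normalization` of `U' → U ⊆ Y` (Stacks, Tag 035H),
and this file PROVES what 4.17 needs of it:

* `isPullback_toNormalization_fromNormalization` — **`N` restricts to `U'` over `U`**: for
  `e : U' → U` integral (e.g. finite) and `ι : U ↪ Y` an open immersion, the square
  `U' → N, U' → U, N → Y, U ↪ Y` is cartesian, so `U' → N` is an open immersion onto the
  preimage of `U` (`isOpenImmersion_toNormalization`). Ingredients, all Mathlib: the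
  normalization commutes with the smooth base change `ι` (Tag 03GV,
  `Scheme.Hom.normalizationPullback`), and the normalization of `Y` in a scheme integral over
  it is that scheme (`IsIso f.toNormalization` for `f` integral), applied to `U' ×_Y U ≅ U'`.
* `isFinite_fromNormalization_comp_ι` — **`N → Y` is finite** when `Y` is an integral scheme
  locally of finite type over a field, `U'` is integral and `e` is finite and surjective: on a
  non-empty affine `V ⊆ Y` the ring of `N` is the integral closure of `Γ(Y, V)` in
  `Γ(U', e⁻¹(V ∩ U))`, a `Γ(Y, V)`-submodule of the integral closure of `Γ(Y, V)` in the
  function field `K(U')`, which is a finite extension of `K(Y)`; the latter integral closure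
  is a finite `Γ(Y, V)`-module by E. Noether's theorem (Liu 2002, Prop. 4.1.27,
  `NoetherFiniteIntegralClosure_holds`), and `Γ(Y, V)` is Noetherian.

Hence (4.17) `N` is a variety finite over `Y` — projective over `k` when `Y` is — containing
`U'` as the open `N ×_Y U`; the closure of the graph of `U' → ℓM̄_{g,n}` is then taken inside
`N ×_k ℓM̄_{g,n}` (companion file).

## References

* A. J. de Jong, *Smoothness, semi-stability and alterations*, Publ. Math. IHÉS 83 (1996), 4.17,
  pp. 71–72. [DeJong1996]
* The Stacks Project, Tag 035H (relative normalization), Tag 03GV (and smooth base change),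
  Tag 0AVK (Nagata / finiteness of normalization for varieties). [StacksProject]
* Q. Liu, *Algebraic Geometry and Arithmetic Curves* (2002), Prop. 4.1.27. [Liu2002]
-/

noncomputable section

open CategoryTheory CategoryTheory.Limits AlgebraicGeometry TopologicalSpace Topology

namespace Literature.AlgebraicGeometry.Resolution

universe u

open Literature.AlgebraicGeometry.Motives

/-! ## The normalization of `Y` in a scheme integral over an open `U ⊆ Y` restricts to it over `U` -/

section Restrict

variable {U' U Y : Scheme.{u}} (e : U' ⟶ U) (ι : U ⟶ Y) [IsOpenImmersion ι] [IsIntegralHom e]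
  [QuasiCompact (e ≫ ι)] [QuasiSeparated (e ≫ ι)]

omit [IsIntegralHom e] [QuasiCompact (e ≫ ι)] [QuasiSeparated (e ≫ ι)] in
/-- For a monomorphism `ι`, the square `𝟙, e, e ≫ ι, ι` is cartesian. [folklore] -/
theorem isPullback_id_of_comp_mono : IsPullback (𝟙 U') e (e ≫ ι) ι :=
  IsPullback.of_horiz_isIso_mono ⟨by simp⟩

/-- **The normalization `N` of `Y` in `U' → U ⊆ Y` restricts to `U'` over `U`**: for `e : U' → U`
integral and `ι : U → Y` an open immersion, the square formed by `U' → N`, `e`, `N → Y` and `ι`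
is cartesian (Stacks 03GV: normalization commutes with smooth base change; and the normalization
of `U` in the integral `U`-scheme `U'` is `U'`). [cite: StacksProject, Tag 03GV] -/
theorem isPullback_toNormalization_fromNormalization :
    IsPullback (e ≫ ι).toNormalization e (e ≫ ι).fromNormalization ι := by
  set f : U' ⟶ Y := e ≫ ι with hf
  have sq1 : IsPullback (𝟙 U') e f ι := isPullback_id_of_comp_mono e ι
  -- the second projection `U' ×_Y U → U` is `e` up to `U' ×_Y U ≅ U'`, hence integral
  have hsnd : pullback.snd f ι = sq1.isoPullback.inv ≫ e := by
    rw [Iso.eq_inv_comp, IsPullback.isoPullback_hom_snd]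
  haveI : IsIntegralHom (pullback.snd f ι) := by
    rw [hsnd]
    exact (MorphismProperty.cancel_left_of_respectsIso @IsIntegralHom _ _).mpr inferInstance
  -- `U' ≅ U' ×_Y U ≅ (U' ×_Y U)^ν ≅ N ×_Y U`
  let χ : U' ⟶ pullback f.fromNormalization ι :=
    sq1.isoPullback.hom ≫ (pullback.snd f ι).toNormalization ≫ f.normalizationPullback ι
  haveI : IsIso χ := by
    dsimp only [χ]
    infer_instance
  have h1 : χ ≫ pullback.fst f.fromNormalization ι = f.toNormalization := by
    simp only [χ, Category.assoc, Scheme.Hom.toNormalization_normalizationPullback_fst]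
    rw [sq1.isoPullback_hom_fst_assoc, Category.id_comp]
  have h2 : χ ≫ pullback.snd f.fromNormalization ι = e := by
    simp only [χ, Category.assoc, Scheme.Hom.normalizationPullback_snd,
      Scheme.Hom.toNormalization_fromNormalization]
    rw [sq1.isoPullback_hom_snd]
  exact IsPullback.of_iso_pullback ⟨by simp⟩ (asIso χ) h1 h2

/-- `U' → N` is an open immersion (onto the preimage of `U`). [folklore] -/
theorem isOpenImmersion_toNormalization : IsOpenImmersion (e ≫ ι).toNormalization :=
  MorphismProperty.of_isPullback (P := @IsOpenImmersion)
    (isPullback_toNormalization_fromNormalization e ι).flip inferInstance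

/-- The image of `U' → N` is the preimage of the image of `U` under `N → Y`. [folklore] -/
theorem range_toNormalization_comp_openImmersion :
    Set.range (e ≫ ι).toNormalization = (e ≫ ι).fromNormalization ⁻¹' Set.range ι := by
  have sq := isPullback_toNormalization_fromNormalization e ι
  rw [← Scheme.Pullback.range_fst, ← sq.isoPullback_hom_fst]
  apply le_antisymm
  · rintro _ ⟨u, rfl⟩
    exact ⟨sq.isoPullback.hom u, (Scheme.Hom.comp_apply _ _ u).symm⟩
  · rintro _ ⟨p, rfl⟩
    obtain ⟨u, rfl⟩ := sq.isoPullback.hom.surjective p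
    exact ⟨u, Scheme.Hom.comp_apply _ _ u⟩

end Restrict

/-! ## Finiteness of the normalization of a variety in a finite cover of one of its opens -/

section Finite

/-- A scheme locally of finite type over a field is locally Noetherian. [folklore] -/
theorem isLocallyNoetherian_of_locallyOfFiniteType_field {Y : Scheme.{u}} {k : Type u} [Field k]
    (g : Y ⟶ Spec (.of k)) [LocallyOfFiniteType g] : IsLocallyNoetherian Y :=
  LocallyOfFiniteType.isLocallyNoetherian g

variable {Y U' : Scheme.{u}} [IsIntegral Y] [IsIntegral U'] (U₀ : Y.Opens)
  (e : U' ⟶ (U₀ : Scheme.{u})) [Surjective e]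

omit [IsIntegral Y] [Surjective e] in
include e in
/-- The open `U₀` is non-empty: `U'` is (being integral) and maps to it. [folklore] -/
theorem nonempty_opens_of_hom : ((U₀ : Set Y)).Nonempty := by
  obtain ⟨x⟩ := (inferInstance : Nonempty U')
  exact ⟨(e x).1, (e x).2⟩

/-- `U' → U₀ ⊆ Y` is dominant: its image is the non-empty open `U₀` of the irreducible `Y`.
[folklore] -/
theorem isDominant_comp_ι : IsDominant (e ≫ U₀.ι) := by
  refine ⟨?_⟩
  have hr : Set.range (e ≫ U₀.ι) = (U₀ : Set Y) := by
    rw [← Scheme.Opens.range_ι U₀]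
    apply le_antisymm
    · rintro _ ⟨x, rfl⟩
      exact ⟨e x, (Scheme.Hom.comp_apply e U₀.ι x).symm⟩
    · rintro _ ⟨u, rfl⟩
      obtain ⟨x, rfl⟩ := e.surjective u
      exact ⟨x, Scheme.Hom.comp_apply e U₀.ι x⟩
  rw [DenseRange, hr]
  exact U₀.2.dense (nonempty_opens_of_hom U₀ e)

/-- Every non-empty open of `Y` has non-empty preimage in `U'`. [folklore] -/
theorem nonempty_preimage_comp_ι (V : Y.Opens) (hV : (V : Set Y).Nonempty) :
    Nonempty ((e ≫ U₀.ι) ⁻¹ᵁ V : U'.Opens) := by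
  have hd : Dense (Set.range (e ≫ U₀.ι)) := (isDominant_comp_ι U₀ e).denseRange
  obtain ⟨y, hyV, ⟨x, rfl⟩⟩ := hd.inter_open_nonempty V V.2 hV
  exact ⟨⟨x, hyV⟩⟩

variable [IsFinite e] {k : Type u} [Field k] (g : Y ⟶ Spec (.of k)) [LocallyOfFiniteType g]

include g in
/-- **Finiteness on an affine chart**: for a non-empty affine open `V ⊆ Y`, the integral closure
of `Γ(Y, V)` in `Γ(U', (V ∩ U₀) ×_{U₀} U')` is a finite `Γ(Y, V)`-module — a submodule of the
integral closure of `Γ(Y, V)` in `K(U')`, `[K(U') : K(Y)] < ∞`, which is finite by E. Noether's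
theorem (Liu 2002, Prop. 4.1.27). [cite: Liu2002, Prop. 4.1.27, p. 122] -/
theorem finite_integralClosure_sections_comp_ι (V : Y.affineOpens) [hV : Nonempty (V : Y.Opens)] :
    letI := ((e ≫ U₀.ι).app V).hom.toAlgebra
    Module.Finite Γ(Y, V) (integralClosure Γ(Y, V) Γ(U', (e ≫ U₀.ι) ⁻¹ᵁ V)) := by
  haveI : IsLocallyNoetherian Y := isLocallyNoetherian_of_locallyOfFiniteType_field g
  haveI := isDominant_comp_ι U₀ e
  set f : U' ⟶ Y := e ≫ U₀.ι with hf
  letI algB := (f.app V).hom.toAlgebra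
  have hVne : ((V : Y.Opens) : Set Y).Nonempty := by
    obtain ⟨x⟩ := hV
    exact ⟨x.1, x.2⟩
  haveI hWne : Nonempty (f ⁻¹ᵁ (V : Y.Opens) : U'.Opens) := nonempty_preimage_comp_ι U₀ e V hVne
  obtain ⟨⟨x₀, hx₀⟩⟩ := id hWne
  -- `Γ(Y, V)` is a finitely generated `k`-algebra and a domain with fraction field `K(Y)`
  let φ : k →+* Γ(Y, V) :=
    (g.appLE ⊤ V le_top).hom.comp (Scheme.ΓSpecIso (.of k)).inv.hom
  have hφ : φ.FiniteType := by
    refine RingHom.FiniteType.comp ?_ (RingHom.FiniteType.of_surjective _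
      (Scheme.ΓSpecIso (.of k)).symm.commRingCatIsoToRingEquiv.surjective)
    exact HasRingHomProperty.appLE @LocallyOfFiniteType g ‹_› ⟨⊤, isAffineOpen_top _⟩ V le_top
  letI : Algebra k Γ(Y, V) := φ.toAlgebra
  haveI : Algebra.FiniteType k Γ(Y, V) := hφ
  haveI : IsFractionRing Γ(Y, V) Y.functionField :=
    functionField_isFractionRing_of_isAffineOpen Y V V.2
  haveI : IsNoetherianRing Γ(Y, V) := Algebra.FiniteType.isNoetherianRing k _
  -- `K(U')` is a finite extension of `K(Y)` along the dominant `f`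
  letI algKK : Algebra Y.functionField U'.functionField := (RatFn.functionFieldMap f).toAlgebra
  haveI : FiniteDimensional Y.functionField U'.functionField := by
    -- a non-empty affine open `A ⊆ U₀`, over which `f` is the finite `e`
    obtain ⟨y, hy⟩ := nonempty_opens_of_hom U₀ e
    obtain ⟨A, hA, hyA, hAU⟩ := exists_isAffineOpen_mem_and_subset (X := Y) (x := y) (U := U₀) hy
    have hAU' : A ≤ U₀.ι.opensRange := by rwa [Scheme.Opens.opensRange_ι]
    have hA₁ : IsAffineOpen (U₀.ι ⁻¹ᵁ A) := hA.preimage_of_isOpenImmersion U₀.ι hAU'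
    have hA₂ : IsAffineOpen (f ⁻¹ᵁ A) := by
      rw [hf, Scheme.Hom.comp_preimage]
      exact hA₁.preimage e
    have hfin : (f.app A).hom.Finite := by
      change ((e.app (U₀.ι ⁻¹ᵁ A)).hom.comp (U₀.ι.app A).hom).Finite
      haveI := U₀.ι.isIso_app A hAU'
      exact RingHom.Finite.comp (e.finite_app _ hA₁)
        (RingHom.Finite.of_surjective _
          (asIso (U₀.ι.app A)).commRingCatIsoToRingEquiv.surjective)
    obtain ⟨u, hu⟩ := e.surjective ⟨y, hAU hyA⟩
    have hu' : f u ∈ A := by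
      rw [hf, Scheme.Hom.comp_apply, hu]
      exact hyA
    exact finiteDimensional_functionField_of_finite_app f hA hA₂ hfin u hu'
  -- `K(U')` as a `Γ(Y, V)`-algebra through `Γ(U', f⁻¹V)`; the tower through `K(Y)` commutes
  letI algL : Algebra Γ(Y, V) U'.functionField :=
    ((U'.germToFunctionField (f ⁻¹ᵁ V)).hom.comp (f.app V).hom).toAlgebra
  haveI : IsScalarTower Γ(Y, V) Γ(U', f ⁻¹ᵁ V) U'.functionField :=
    IsScalarTower.of_algebraMap_eq fun _ => rfl
  haveI : IsScalarTower Γ(Y, V) Y.functionField U'.functionField := by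
    refine IsScalarTower.of_algebraMap_eq fun a => ?_
    change U'.germToFunctionField (f ⁻¹ᵁ V) (f.app V a) =
      RatFn.functionFieldMap f (Y.germToFunctionField V a)
    exact (functionFieldMap_germToFunctionField f V a x₀ hx₀).symm
  -- E. Noether
  have hfin : Module.Finite Γ(Y, V) (integralClosure Γ(Y, V) U'.functionField) :=
    NoetherFiniteIntegralClosure_holds k Γ(Y, V) Y.functionField U'.functionField
  haveI : IsNoetherian Γ(Y, V) (integralClosure Γ(Y, V) U'.functionField) :=
    isNoetherian_of_isNoetherianRing_of_finite _ _
  -- the integral closure in `Γ(U', f⁻¹V) ⊆ K(U')` embeds into the one in `K(U')`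
  let ψ : Γ(U', f ⁻¹ᵁ V) →ₐ[Γ(Y, V)] U'.functionField :=
    IsScalarTower.toAlgHom Γ(Y, V) Γ(U', f ⁻¹ᵁ V) U'.functionField
  have hψ : Function.Injective ψ := U'.germToFunctionField_injective (f ⁻¹ᵁ V)
  let θ : integralClosure Γ(Y, V) Γ(U', f ⁻¹ᵁ V) →ₗ[Γ(Y, V)]
      integralClosure Γ(Y, V) U'.functionField :=
    { toFun := fun x => ⟨ψ x, x.2.map ψ⟩
      map_add' := fun x y => by ext; simp
      map_smul' := fun a x => by ext; simp }
  refine Module.Finite.of_injective θ fun x y hxy => ?_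
  exact Subtype.ext (hψ (congrArg Subtype.val hxy))

/-- **The normalization of a variety in a finite cover of one of its opens is finite over it**:
for `Y` integral and locally of finite type over a field `k`, `U₀ ⊆ Y` open, `U'` integral and
`e : U' → U₀` finite surjective, the relative normalization `N → Y` of `U' → U₀ ⊆ Y` is a
finite morphism (E. Noether's theorem on the affine charts, `finite_integralClosure_sections_comp_ι`).
In 4.17 this makes `N` — a variety containing `U'` as the open `N ×_Y U₀` — projective over `k`
along with `Y`. [cite: DeJong1996, 4.17, p. 72] -/
theorem isFinite_fromNormalization_comp_ι :
    haveI : IsLocallyNoetherian Y := isLocallyNoetherian_of_locallyOfFiniteType_field g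
    IsFinite (e ≫ U₀.ι).fromNormalization := by
  haveI : IsLocallyNoetherian Y := isLocallyNoetherian_of_locallyOfFiniteType_field g
  exact isFinite_fromNormalization_of_finite (e ≫ U₀.ι)
    (fun V : {V : Y.affineOpens // Nonempty (V : Y.Opens)} => V.1)
    (iSup_nonempty_affineOpens_eq_top Y)
    fun V => haveI := V.2; finite_integralClosure_sections_comp_ι U₀ e g V.1

end Finite

end Literature.AlgebraicGeometry.Resolution

end
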